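import Summits.BirchSwinnertonDyer.BirchSwinnertonDyer.Theorems.AlignedTransportAtTwoMainConjectureTransportAlignedAtTwoKilfordCopyMultiplicityCard
import Summits.BirchSwinnertonDyer.BirchSwinnertonDyer.Theorems.AlignedTransportAtTwoMainConjectureTransportAlignedAtTwoDeltaPosJacobian
import Literature.NumberTheory.EllipticCurves.ModularJacobianMultiplicityOneCosocleProofs
import Mathlib.RingTheory.Finiteness.Cardinality
import HarnessLib

/-!
# Crux C1 `MainConjectureTransportAlignedAtTwo` (stmt-BirchSwinnertonDyer-22296), line `birth`, residual (R2) `stub_lamLawKilford` (Kilford stratum):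
# the T1 HALF of the kernel-letter carrier — `J₀(N)[2]` as a finite `2`-group with the Galois action of `ModularJacobianGaloisData`, the half-class map
# `H₁(X₀(N);ℤ) ↠ J₀(N)[2]`, the parametrisations on `2`-torsion, and `#J₀(N)[𝔪_f] = 16` inside it (width seat att-p4 g17; `--supports 22296`)

THEOREMS ONLY (no `def`, no `sorry`, no named fact, no instance). BSD is not proved by this; C1 is not closed by this.

The additive-currency consumer (`…KilfordKernelLetterAdditive` / `…KilfordKernelLetterCapstone`, this seat) wants, on a finite abelian group `A` killed by `2`:
`act : Γ_ℚ → A →+ A` with the monoid laws, `q : H₁(X₀(N);ℤ) → A`, `θ_D : A →+ W[2]` equivariant with `ι (θ_D (q y)) = D.jacobiMap [y/2]`, and `U ≤ A` with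
`#U = 16`. This file supplies ALL of these from the tree for the CONCRETE
`A = ↥(Submodule.torsionBy 𝕋 (J0 N) 2) = J₀(N)(ℂ)[2]` and a `ℚ`-structure carrier `J : ModularJacobianGaloisData N ι` (typing T1):
* §1 `two_nsmul_eq_zero`, `exists_halfMap` (`q`, onto: every `2`-torsion point is a half-class), **`finite_twoTorsion`** (`J₀(N)[2]` is finite: a quotient of the
  finitely generated `Λ`, killed by `2`);
* §2 **`exists_act`** (`galAct` restricted to `J₀(N)[2]`: additive, unital, multiplicative, Hecke-linear);
* §3 **`exists_theta`** (`θ_D`: the unique `P ∈ W[2](ℚ̄)` with `ι P = D.jacobiMap a`; additive; `Γ_ℚ`-EQUIVARIANT for any `act` reading `galAct` — `jacobiMap_galAct`);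
* §4 **`natCard_torsionBySet_comap_eq_sixteen`** (`U = J₀(N)[𝔪_f]` seen inside `A` has `16` elements under MULT2's conclusion — att-p3 g17
  `natCard_torsionBySet_eq_sixteen_of_isNewformOf`), `mem_torsionBySet_comap_iff`.
What the carrier must still DEFINE on `A`: the pairing `B` (W3) and the multiplicative part `M` with its socle set (W1), (W0′).

References: H. Darmon, F. Diamond, R. Taylor (1995) §1.3, §1.5, §1.7 [DarmonDiamondTaylor1995]; J. H. Silverman, AEC (2009) III.§7 [SilvermanAEC2009];
L. J. P. Kilford, G. Wiese (2008) Question 1.9 [KilfordWiese2008].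
-/

set_option autoImplicit false

noncomputable section

-- justification: the `Summit.BirchSwinnertonDyer.BirchSwinnertonDyer.…` path repeats a component (route-file convention)
set_option linter.dupNamespace false

open scoped MatrixGroups ModularForm Classical
open CongruenceSubgroup WeierstrassCurve
open Literature.NumberTheory.EllipticCurves Literature.NumberTheory.EllipticCurves.ModularForms
open Summit.BirchSwinnertonDyer.Rank1Residual.F1Sign2
open Summit.BirchSwinnertonDyer.BirchSwinnertonDyer.Theorems.AlignedTransportAtTwoDeltaPosJacobian
open Summit.BirchSwinnertonDyer.BirchSwinnertonDyer.Theorems.AlignedTransportAtTwoKilfordCopyMultiplicityCard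

namespace Summit.BirchSwinnertonDyer.BirchSwinnertonDyer.Theorems.AlignedTransportAtTwoKilfordKernelLetterTorsion

variable (N : ℕ) [NeZero N]

/-! ## §1 `J₀(N)[2]` as a finite `2`-group and the half-class map -/

/-- Every element of `J₀(N)[2] = ↥(torsionBy 𝕋 (J0 N) 2)` is killed by `2`. [folklore] -/
theorem two_nsmul_eq_zero (a : ↥(Submodule.torsionBy (HeckeRing0 N 2) (J0 N) 2)) : 2 • a = 0 := by
  apply Subtype.ext
  have h := (Submodule.mem_torsionBy_iff (2 : HeckeRing0 N 2) (a : J0 N)).mp a.2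
  rw [ofNat_smul_eq_nsmul (HeckeRing0 N 2) 2 (a : J0 N)] at h
  rw [AddSubmonoidClass.coe_nsmul]
  exact h

/-- A half-class `[y/2]`, `y ∈ Λ`, lies in `J₀(N)[2]`. [cite: DarmonDiamondTaylor1995, §1.3 (p. 27)] -/
theorem half_mem_torsionBy (y : periodHomologyHecke N) :
    (Submodule.Quotient.mk ((2 : ℂ)⁻¹ • (y : Module.Dual ℂ (CuspForm (Gamma0 N) 2))) : J0 N) ∈
      Submodule.torsionBy (HeckeRing0 N 2) (J0 N) 2 := by
  rw [Submodule.mem_torsionBy_iff, ofNat_smul_eq_nsmul (HeckeRing0 N 2) 2, two_nsmul]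
  exact half_add_half_eq_zero y.2

/-- **The half-class map `q : Λ ↠ J₀(N)[2]`, `y ↦ [y/2]`**, additive and ONTO (every `2`-torsion point of `V/Λ` is a half-class).
[cite: DarmonDiamondTaylor1995, §1.3 (p. 27)] -/
theorem exists_halfMap :
    ∃ q : periodHomologyHecke N →+ ↥(Submodule.torsionBy (HeckeRing0 N 2) (J0 N) 2),
      (∀ y : periodHomologyHecke N, ((q y : ↥(Submodule.torsionBy (HeckeRing0 N 2) (J0 N) 2)) : J0 N) =
        Submodule.Quotient.mk ((2 : ℂ)⁻¹ • (y : Module.Dual ℂ (CuspForm (Gamma0 N) 2)))) ∧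
      Function.Surjective q := by
  refine ⟨{ toFun := fun y => ⟨_, half_mem_torsionBy N y⟩
            map_zero' := Subtype.ext (by simp)
            map_add' := fun y z => Subtype.ext (by
              simp only [Submodule.coe_add, smul_add, Submodule.Quotient.mk_add, Submodule.coe_add]) },
    fun y => rfl, ?_⟩
  rintro ⟨a, ha⟩
  have haa : a + a = 0 := by
    have h := (Submodule.mem_torsionBy_iff (2 : HeckeRing0 N 2) a).mp ha
    rwa [ofNat_smul_eq_nsmul (HeckeRing0 N 2) 2, two_nsmul] at h
  obtain ⟨x, hx, hxa⟩ := exists_half_eq haa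
  exact ⟨⟨x, (mem_periodHomologyHecke N).mpr hx⟩, Subtype.ext hxa⟩

/-- **`J₀(N)[2]` is finite**: it is a quotient of the finitely generated `ℤ`-module `Λ = H₁(X₀(N);ℤ)` killed by `2`. [cite: DarmonDiamondTaylor1995, §1.3 (p. 27)] -/
theorem finite_twoTorsion : Finite ↥(Submodule.torsionBy (HeckeRing0 N 2) (J0 N) 2) := by
  obtain ⟨q, -, hq⟩ := exists_halfMap N
  haveI := moduleFinite_int_periodHomologyHecke N
  haveI : Module.Finite ℤ ↥(Submodule.torsionBy (HeckeRing0 N 2) (J0 N) 2) :=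
    Module.Finite.of_surjective q.toIntLinearMap hq
  letI : Module (ZMod 2) ↥(Submodule.torsionBy (HeckeRing0 N 2) (J0 N) 2) := AddCommGroup.zmodModule (two_nsmul_eq_zero N)
  haveI : Module.Finite (ZMod 2) ↥(Submodule.torsionBy (HeckeRing0 N 2) (J0 N) 2) :=
    Module.Finite.of_restrictScalars_finite ℤ (ZMod 2) _
  exact Module.finite_of_finite (ZMod 2)

/-! ## §2 The Galois action of the `ℚ`-structure on `J₀(N)[2]` -/

/-- `J₀(N)[2] ≤ J₀(N)_tors`. [cite: DarmonDiamondTaylor1995, §1.3 (p. 27)] -/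
theorem torsionBy_two_le_tors : Submodule.torsionBy (HeckeRing0 N 2) (J0 N) 2 ≤ J0.tors N :=
  J0.torsionBy_le_tors N (ℓ := 2) two_ne_zero

/-- **`Γ_ℚ` acts on `J₀(N)[2]`** through the `ℚ`-structure `J` (`galAct` is additive, so it preserves the `2`-torsion): there is
`act : Γ_ℚ → J₀(N)[2] →+ J₀(N)[2]` READING `galAct`. Its laws follow from the reading (`act_one`, `act_mul`, `act_smul`).
[cite: DarmonDiamondTaylor1995, §1.5 (p. 36)] -/
theorem exists_act (ι : AlgebraicClosure ℚ →+* ℂ) (J : ModularJacobianGaloisData N ι) :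
    ∃ act : Field.absoluteGaloisGroup ℚ →
        ↥(Submodule.torsionBy (HeckeRing0 N 2) (J0 N) 2) →+ ↥(Submodule.torsionBy (HeckeRing0 N 2) (J0 N) 2),
      ∀ (σ : Field.absoluteGaloisGroup ℚ) (a : ↥(Submodule.torsionBy (HeckeRing0 N 2) (J0 N) 2)),
        ((act σ a : ↥(Submodule.torsionBy (HeckeRing0 N 2) (J0 N) 2)) : J0 N) =
          ((J.galAct σ ⟨a, torsionBy_two_le_tors N a.2⟩ : J0.tors N) : J0 N) := by
  -- `galAct σ` preserves the `2`-torsion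
  have hmem : ∀ (σ : Field.absoluteGaloisGroup ℚ) (a : ↥(Submodule.torsionBy (HeckeRing0 N 2) (J0 N) 2)),
      ((J.galAct σ ⟨a, torsionBy_two_le_tors N a.2⟩ : J0.tors N) : J0 N) ∈ Submodule.torsionBy (HeckeRing0 N 2) (J0 N) 2 := by
    intro σ a
    rw [Submodule.mem_torsionBy_iff, ← Submodule.coe_smul, ← J.galAct_smul]
    have h2 : (2 : HeckeRing0 N 2) • (⟨a, torsionBy_two_le_tors N a.2⟩ : J0.tors N) = 0 :=
      Subtype.ext ((Submodule.mem_torsionBy_iff (2 : HeckeRing0 N 2) (a : J0 N)).mp a.2)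
    rw [h2, map_zero, Submodule.coe_zero]
  have hadd : ∀ (σ : Field.absoluteGaloisGroup ℚ) (a b : ↥(Submodule.torsionBy (HeckeRing0 N 2) (J0 N) 2)),
      (⟨_, hmem σ (a + b)⟩ : ↥(Submodule.torsionBy (HeckeRing0 N 2) (J0 N) 2)) = ⟨_, hmem σ a⟩ + ⟨_, hmem σ b⟩ := by
    intro σ a b
    apply Subtype.ext
    have hab : (⟨((a + b : ↥(Submodule.torsionBy (HeckeRing0 N 2) (J0 N) 2)) : J0 N), torsionBy_two_le_tors N (a + b).2⟩ : J0.tors N) =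
        ⟨(a : J0 N), torsionBy_two_le_tors N a.2⟩ + ⟨(b : J0 N), torsionBy_two_le_tors N b.2⟩ := Subtype.ext rfl
    show ((J.galAct σ ⟨((a + b : ↥(Submodule.torsionBy (HeckeRing0 N 2) (J0 N) 2)) : J0 N), torsionBy_two_le_tors N (a + b).2⟩ :
        J0.tors N) : J0 N) =
      ((J.galAct σ ⟨(a : J0 N), torsionBy_two_le_tors N a.2⟩ : J0.tors N) : J0 N) +
        ((J.galAct σ ⟨(b : J0 N), torsionBy_two_le_tors N b.2⟩ : J0.tors N) : J0 N)
    rw [hab, map_add, Submodule.coe_add]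
  exact ⟨fun σ => AddMonoidHom.mk' (fun a => ⟨_, hmem σ a⟩) (hadd σ), fun σ a => rfl⟩

section ActLaws

variable {N} {ι : AlgebraicClosure ℚ →+* ℂ} (J : ModularJacobianGaloisData N ι)
  (act : Field.absoluteGaloisGroup ℚ →
    ↥(Submodule.torsionBy (HeckeRing0 N 2) (J0 N) 2) →+ ↥(Submodule.torsionBy (HeckeRing0 N 2) (J0 N) 2))
  (hact : ∀ (σ : Field.absoluteGaloisGroup ℚ) (a : ↥(Submodule.torsionBy (HeckeRing0 N 2) (J0 N) 2)),
    ((act σ a : ↥(Submodule.torsionBy (HeckeRing0 N 2) (J0 N) 2)) : J0 N) =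
      ((J.galAct σ ⟨a, torsionBy_two_le_tors N a.2⟩ : J0.tors N) : J0 N))
include hact

/-- An `act` reading `galAct` is unital. [cite: DarmonDiamondTaylor1995, §1.5 (p. 36)] -/
theorem act_one (a : ↥(Submodule.torsionBy (HeckeRing0 N 2) (J0 N) 2)) : act 1 a = a := by
  apply Subtype.ext
  rw [hact, map_one]
  rfl

/-- An `act` reading `galAct` is multiplicative. [cite: DarmonDiamondTaylor1995, §1.5 (p. 36)] -/
theorem act_mul (σ τ : Field.absoluteGaloisGroup ℚ) (a : ↥(Submodule.torsionBy (HeckeRing0 N 2) (J0 N) 2)) :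
    act (σ * τ) a = act σ (act τ a) := by
  apply Subtype.ext
  have h : (⟨((act τ a : ↥(Submodule.torsionBy (HeckeRing0 N 2) (J0 N) 2)) : J0 N), torsionBy_two_le_tors N (act τ a).2⟩ : J0.tors N) =
      J.galAct τ ⟨(a : J0 N), torsionBy_two_le_tors N a.2⟩ := Subtype.ext (hact τ a)
  rw [hact, hact, h, map_mul, LinearEquiv.mul_apply]

/-- An `act` reading `galAct` commutes with the Hecke ring. [cite: DarmonDiamondTaylor1995, §1.5 (p. 36)] -/
theorem act_smul (σ : Field.absoluteGaloisGroup ℚ) (t : HeckeRing0 N 2) (a : ↥(Submodule.torsionBy (HeckeRing0 N 2) (J0 N) 2)) :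
    act σ (t • a) = t • act σ a := by
  apply Subtype.ext
  have hta : (⟨((t • a : ↥(Submodule.torsionBy (HeckeRing0 N 2) (J0 N) 2)) : J0 N), torsionBy_two_le_tors N (t • a).2⟩ : J0.tors N) =
      t • ⟨(a : J0 N), torsionBy_two_le_tors N a.2⟩ := Subtype.ext rfl
  have lhs : ((act σ (t • a) : ↥(Submodule.torsionBy (HeckeRing0 N 2) (J0 N) 2)) : J0 N) =
      t • ((J.galAct σ ⟨(a : J0 N), torsionBy_two_le_tors N a.2⟩ : J0.tors N) : J0 N) := by
    rw [hact, hta, J.galAct_smul, Submodule.coe_smul]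
  have rhs : ((t • act σ a : ↥(Submodule.torsionBy (HeckeRing0 N 2) (J0 N) 2)) : J0 N) =
      t • ((J.galAct σ ⟨(a : J0 N), torsionBy_two_le_tors N a.2⟩ : J0.tors N) : J0 N) := by
    rw [Submodule.coe_smul, hact]
  exact lhs.trans rhs.symm

end ActLaws

/-! ## §3 The parametrisations on `2`-torsion -/

/-- **The parametrisation of `W` on `J₀(N)[2]`**: for a datum `D` and an embedding `ι : ℚ̄ → ℂ` there is an additive `θ : J₀(N)[2] → W[2](ℚ̄)` with
`ι (θ a) = D.jacobiMap a`; it is `Γ_ℚ`-EQUIVARIANT for every `act` reading the `ℚ`-structure's `galAct` (`jacobiMap_galAct`). With the half-class map `q`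
of `exists_halfMap`: `ι (θ (q y)) = D.jacobiMap [y/2]`. [cite: DarmonDiamondTaylor1995, §1.5 and §1.7] [cite: SilvermanAEC2009, III.§7] -/
theorem exists_theta (ι : AlgebraicClosure ℚ →+* ℂ) (J : ModularJacobianGaloisData N ι)
    {W : WeierstrassCurve ℚ} [W.IsElliptic] (D : ModularParametrizationData W N) :
    ∃ θ : ↥(Submodule.torsionBy (HeckeRing0 N 2) (J0 N) 2) →+ ↥(W.geomTorsion 2),
      (∀ a, W.geomPointsToComplex ι (θ a : W.geomPoints) = D.jacobiMap (a : J0 N)) ∧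
      (∀ act : Field.absoluteGaloisGroup ℚ →
          ↥(Submodule.torsionBy (HeckeRing0 N 2) (J0 N) 2) →+ ↥(Submodule.torsionBy (HeckeRing0 N 2) (J0 N) 2),
        (∀ (σ : Field.absoluteGaloisGroup ℚ) (a : ↥(Submodule.torsionBy (HeckeRing0 N 2) (J0 N) 2)),
          ((act σ a : ↥(Submodule.torsionBy (HeckeRing0 N 2) (J0 N) 2)) : J0 N) =
            ((J.galAct σ ⟨a, torsionBy_two_le_tors N a.2⟩ : J0.tors N) : J0 N)) →
        ∀ (σ : Field.absoluteGaloisGroup ℚ) (a : ↥(Submodule.torsionBy (HeckeRing0 N 2) (J0 N) 2)), θ (act σ a) = σ • θ a) := by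
  have h2 : ∀ a : ↥(Submodule.torsionBy (HeckeRing0 N 2) (J0 N) 2), D.jacobiMap (a : J0 N) + D.jacobiMap (a : J0 N) = 0 := fun a => by
    rw [← map_add, ← Submodule.coe_add, ← two_nsmul, two_nsmul_eq_zero N a, Submodule.coe_zero, map_zero]
  have hex : ∀ a : ↥(Submodule.torsionBy (HeckeRing0 N 2) (J0 N) 2), ∃! P : geomTorsion W (2 : ℤ),
      W.geomPointsToComplex ι (P : W.geomPoints) = D.jacobiMap (a : J0 N) := fun a => existsUnique_geomTorsion_eq W ι (h2 a)
  choose θf hθf using fun a => (hex a).exists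
  have uniq : ∀ (a : ↥(Submodule.torsionBy (HeckeRing0 N 2) (J0 N) 2)) (P : geomTorsion W (2 : ℤ)),
      W.geomPointsToComplex ι (P : W.geomPoints) = D.jacobiMap (a : J0 N) → P = θf a :=
    fun a P hP => (hex a).unique hP (hθf a)
  refine ⟨{ toFun := θf
            map_zero' := by
              symm; apply uniq
              rw [ZeroMemClass.coe_zero, map_zero, ZeroMemClass.coe_zero, map_zero]
            map_add' := fun a b => by
              symm; apply uniq
              rw [AddSubgroup.coe_add, map_add, hθf, hθf, Submodule.coe_add, map_add] },
    fun a => hθf a, fun act hact σ a => ?_⟩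
  show θf (act σ a) = σ • θf a
  symm; apply uniq
  rw [AddSubgroup.torsionBy.coe_smul, hact σ a]
  exact (J.jacobiMap_galAct W D σ ⟨(a : J0 N), torsionBy_two_le_tors N a.2⟩ (θf a : W.geomPoints) (hθf a).symm).symm

/-! ## §4 `U = J₀(N)[𝔪_f]` inside `J₀(N)[2]` -/

variable {N}

/-- `2 ∈ 𝔪_f`, so `J₀(N)[𝔪_f] ≤ J₀(N)[2]`. [folklore] -/
theorem torsionBySet_le_torsionBy_two (f : CuspForm (Gamma0 N) 2) :
    Submodule.torsionBySet (HeckeRing0 N 2) (J0 N) (modTwoHeckeIdeal f : Set (HeckeRing0 N 2)) ≤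
      Submodule.torsionBy (HeckeRing0 N 2) (J0 N) 2 := by
  intro x hx
  rw [Submodule.mem_torsionBySet_iff] at hx
  rw [Submodule.mem_torsionBy_iff]
  have h2 : (2 : HeckeRing0 N 2) ∈ (modTwoHeckeIdeal f : Set (HeckeRing0 N 2)) :=
    Ideal.mem_sup_right (Ideal.mem_span_singleton_self (2 : HeckeRing0 N 2))
  exact hx ⟨2, h2⟩

/-- Membership in `U = J₀(N)[𝔪_f]` seen inside `J₀(N)[2]`: `a ∈ U ↔ ∀ t ∈ 𝔪_f, t·a = 0`. [folklore] -/
theorem mem_torsionBySet_comap_iff (f : CuspForm (Gamma0 N) 2) (a : ↥(Submodule.torsionBy (HeckeRing0 N 2) (J0 N) 2)) :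
    a ∈ (Submodule.torsionBySet (HeckeRing0 N 2) (J0 N) (modTwoHeckeIdeal f : Set (HeckeRing0 N 2))).comap
        (Submodule.torsionBy (HeckeRing0 N 2) (J0 N) 2).subtype ↔
      ∀ t ∈ modTwoHeckeIdeal f, t • a = 0 := by
  rw [Submodule.mem_comap, Submodule.subtype_apply, Submodule.mem_torsionBySet_iff]
  constructor
  · intro h t ht
    exact Subtype.ext (by rw [Submodule.coe_smul, Submodule.coe_zero]; exact h ⟨t, ht⟩)
  · rintro h ⟨t, ht⟩
    have := congrArg Subtype.val (h t ht)
    rwa [Submodule.coe_smul, Submodule.coe_zero] at this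

/-- **`#U = 16` inside `J₀(N)[2]`** under the conclusion of `F1Sign2.MultiplicityTwoOnStratumAtTwo` at `(N, f)` (att-p3 g17
`natCard_torsionBySet_eq_sixteen_of_isNewformOf`). [cite: KilfordWiese2008, Question 1.9] -/
theorem natCard_torsionBySet_comap_eq_sixteen {W : WeierstrassCurve ℚ} [W.IsElliptic] {f : CuspForm (Gamma0 N) 2} (hf : IsNewformOf W f)
    (h4 : Module.finrank (HeckeRing0 N 2 ⧸ modTwoHeckeIdeal f)
      (Submodule.torsionBySet (HeckeRing0 N 2) (J0 N) (modTwoHeckeIdeal f)) = 4) :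
    Nat.card ↥((Submodule.torsionBySet (HeckeRing0 N 2) (J0 N) (modTwoHeckeIdeal f : Set (HeckeRing0 N 2))).comap
        (Submodule.torsionBy (HeckeRing0 N 2) (J0 N) 2).subtype) = 16 := by
  rw [Nat.card_congr (Submodule.comapSubtypeEquivOfLe (torsionBySet_le_torsionBy_two f)).toEquiv]
  exact natCard_torsionBySet_eq_sixteen_of_isNewformOf hf h4

end Summit.BirchSwinnertonDyer.BirchSwinnertonDyer.Theorems.AlignedTransportAtTwoKilfordKernelLetterTorsion

end
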